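import Summits.HodgeConjecture.HodgeConjecture.Theorems.Ring2AbelianAllStandardAPencilsTransport
import Summits.HodgeConjecture.HodgeConjecture.Theorems.Ring2AbelianAllStandardAPencilsLowRungs
import Summits.HodgeConjecture.HodgeConjecture.Theorems.Ring2HypothesesDescentHolds
import Literature.AlgebraicGeometry.HodgeTheory.MotivatedClassesPointAuxiliary
import Literature.AlgebraicGeometry.HodgeTheory.LefschetzStandardConjectureFacts
import HarnessLib

/-!
# Ring 2 — hypotheses layer, descent axis: binder row b05 and its parent ON THE STANDARD-CONJECTURE SIDE —
# `A_mot(X) ⊆ A(X)` below the middle codimension gives Grothendieck's `A(X, η)`; print's letter `X_A` lies BETWEEN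
# the parent binder `MotivatedImpliesAlgebraic` and row b05 `MotivatedImpliesAlgebraicAV`

HONEST FRAMING (page 1, verbatim the cell's standing line): **research route conditional on HC_CM; not a
corollary; Q11.4-sentence-2 already refuted in dim ≥ 3.** Nothing in this file proves a case of the Hodge
conjecture or of a standard conjecture beyond what the tree already has; nothing asserts `HC_CM`
(= `Theses.RankFourFaces.CMAbelianHodge`, a BINDER of the cell, referred to by name only, never restated),
`HC_AV` (= `Theses.PadicSemiregularLift.HodgeAbelianVarieties`), row b05, its parent, or `X_A`.

Hodge ladder STAGE 3, `BINDER-OWNERS.md` row **b05** (`Ring2.Hypotheses.MotivatedImpliesAlgebraicAV`,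
`Ring2HypothesesDescent.lean` l.177; parent `MotivatedImpliesAlgebraic`, l.167): "published modulo `X`", `X` =
standard conjecture `B` for the total spaces of compact abelian pencils, typed in the tree as
`Ring2.AbelianAll.CompactAbelianPencilLefschetz` (`⋆_L`-form) and, in print's own letter (Abdulali 1994 p. 1122 /
Milne 2020 Prop. 1 as printed), `X_A := Ring2.AbelianAll.CompactAbelianPencilStandardA` (Grothendieck's `A(𝒳, η)`
for every polarisation class of every pencil total space). The tree has the arrows INTO row b05 —
`B(all) ⟹ parent` (André §2.1, named fact `hBA`), `X ⟹ b05`, `X_A ⟹ b05` (modulo `h₈`/`h₈A`, `h₂₁`, `h₂₂`;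
`Ring2AbelianAllLefschetzPencilsOnPath` :123, `Ring2HypothesesDescentMotivatedRungs` :94). This file adds the
arrows OUT OF the motivated binders towards the standard conjectures, all kernel-checked and FACT-FREE
(no named fact, no `HC_CM`):

* §1 PER VARIETY (the lemma everything else specialises): for `X` smooth projective of dimension `n` and `η`
  ANY polarisation class, **`A_motᵖ(X)_ℂ ⊆ Nᵖ H²ᵖ(X(ℂ); ℂ)` for the codimensions `2 ≤ p < n/2` ALONE implies
  Grothendieck's `A(X, η)`** (`standardConjectureA_of_motivatedClasses_le_algebraicClasses`). Print: André 1996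
  §2.1, remark following Déf. 1 (p. 14), "Il est clair que `A_mot(X)_E` contient `A(X)` et `*A(X)`" — the tree
  THEOREM `lefschetzInvolution_mem_motivatedClasses` (`*_L A(X) ⊆ A_mot(X)`) — so `A_mot ⊆ A` forces
  `*_L A(X) ⊆ A(X)`, which is clause (b) of `A(X)` ("`Lʳ : Cᵖ(X) → Cⁿ⁻ᵖ(X)` an epimorphism", Grothendieck 1968 §3
  p. 196) because `Lʳ ∘ *_L = id` above the middle; codimensions `p ≤ 1` and the middle one are unconditional
  (`Ring2.AbelianAll.standardConjectureA_of_surjOn_two_le`: Lefschetz `(1,1)`, hard Lefschetz).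
* §2 THE PARENT BINDER: `MotivatedImpliesAlgebraic ⟹ A(X, η)` for EVERY smooth projective complex `X` and every
  polarisation class; with André's §2.1 fact `hBA` the parent binder is SANDWICHED between the two printed forms
  of the Lefschetz standard conjecture, `B⋆(all) ⟹[hBA] MotivatedImpliesAlgebraic ⟹[kernel] A(all)`
  (`motivatedImpliesAlgebraic_between_standardConjectures`; in print `A(X × X) ⟹ B(X)`, Grothendieck loc. cit.,
  closes the circle — not in the tree, not claimed).
* §3 THE PENCIL NODES: `MotivatedImpliesAlgebraic ⟹ X_A` (and `⟹ A_pen^CM`); SHARPER, the graded node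
  `StandardACompactPencilsAtRelDim d` follows from "motivated ⟹ algebraic" on the `(d+1)`-fold pencil total spaces
  in the codimensions `2 ≤ p`, `2p < d + 1` only — so **the first open `A`-rung `d = 4`** (part XIV-c
  `standardACompactPencilsAtRelDim_four_iff_surjOn`: one surjectivity `L_η(N² H⁴) ⊇ N³ H⁶` per pencil and `η`)
  **follows from the single, `η`-free inclusion `A_mot²(𝒳)_ℂ ⊆ N² H⁴(𝒳(ℂ); ℂ)` on fivefold total spaces** —
  a sufficient condition finer than "Hodge classes of codimension `2` on `𝒳` are algebraic"
  (`A_mot² ⊆ span Hdg²`, André §2.5 c)).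
* §4 THE PLACEMENT OF `X_A`: **`MotivatedImpliesAlgebraic ⟹ X_A ⟹ MotivatedImpliesAlgebraicAV`**, the second arrow
  modulo the three displayed print binders `h₈A h₂₁ h₂₂` (landed, imported by name): print's letter lies
  BETWEEN the parent binder and row b05 (`compactAbelianPencilStandardA_between_motivatedBinders`). Hence also a
  NEW sufficient package for `HC_AV` on this axis that does not pass through André's Thm. 0.6.2: "motivated ⟹
  algebraic on compact-abelian-pencil TOTAL SPACES below the middle" `∧ h₈A ∧ h₂₁ ∧ h₂₂ ⟹ HC_AV`
  (`hc_av_of_abdulaliA_of_andre1996_of_motivatedClasses_le_total`).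
* §5 ROW b05 ITSELF on this side: `MotivatedImpliesAlgebraicAV ⟹ A(A, η)` for every complex abelian variety and
  polarisation class, indeed from the LOWER HALF `2 ≤ p < dim A / 2` of the row's middle range — in print void
  (`A(A)` is Lieberman's theorem 1968; in the tree `B⋆(A)` is the unproved named fact
  `Lieberman1968_lefschetzInvolution_algebraic_abelianVariety`, whose `A`-form consequence row b05 thus yields
  fact-free: `standardConjectureA_abelianVariety_of_lieberman` vs `…_of_motivatedImpliesAlgebraicAV`).
* §6 one ledger conjunction a referee can quote.

Discharge status of row b05 after this file: UNCHANGED (OPEN; `BINDER-OWNERS.md` «10 · 0» does not move). What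
is new is direction: the motivated binders now have kernel arrows INTO the standard-conjecture nodes `A(all)`,
`X_A`, `A_pen^CM`, `(A∀)_d`, not only out of them.

References (bib keys): Andre1996Motifs (§2.1 Déf. 1 and remark p. 14; §2.5 c) p. 18; Thm. 0.6.2 p. 9; §6.3
Remarque 2 p. 33; Appendix A.2 p. 44), Grothendieck1968 (§3 p. 196: `A(X)`, `B(X)`, "`B(X) ⇒ A(X)`",
"`A(X × X) ⇒ B(X)`"), Kleiman1968AlgebraicCycles (§2, Thm. 2A11), Lieberman1968 (main theorem),
Abdulali1994FamiliesAV (p. 1122), Milne2020HodgeClassesAV (Prop. 1, Thm. 4), VoisinHodgeI2002 (Thm. 6.25,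
Thm. 11.30).
-/

set_option linter.dupNamespace false

noncomputable section

open CategoryTheory
open Literature.AlgebraicGeometry Literature.AlgebraicGeometry.Motives
open Literature.AlgebraicGeometry.HodgeTheory
open Literature.AlgebraicTopology.SingularHomology Literature.Geometry.Kaehler
open Literature.AlgebraicGeometry.Abdulali1994 (Abdulali1994_invariantCycles_of_lefschetzStandardA)
open Literature.AlgebraicGeometry.Andre1996 (andre1996_cmAnchoredPencil
  andre1996_cmHodgeClasses_algebraicallyAnchoredPencils)
open Summit.HodgeConjecture.HodgeConjecture.Ring2.AbelianAll (CompactAbelianPencilStandardA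
  CMPointedPencilStandardA StandardACompactPencilsAtRelDim StandardACMPointedPencilsAtRelDim
  standardConjectureA_of_surjOn_two_le standardConjectureA_of_standardConjectureBStar
  cmPointedPencilStandardA_of_compactAbelianPencilStandardA standardACMPointedPencilsAtRelDim_of_compact
  HC_AV_and_HC_CM_of_abdulaliA_of_andre1996_of_compactAbelianPencilStandardA)

namespace Summit.HodgeConjecture.HodgeConjecture.Ring2.Hypotheses

/-! ## §1 Per variety: `A_mot(X) ⊆ A(X)` below the middle codimension gives `A(X, η)` -/

section PerVariety

variable {n : ℕ} {X : SchemeOver ℂ} {η : complexBetti X 2}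

/-- **Clause (b) of `A(X, η)`, "onto", in ONE codimension, from `A_motᵖ(X)_ℂ ⊆ Nᵖ H²ᵖ(X(ℂ); ℂ)`**: let `X` be
smooth projective of dimension `n`, `η` a polarisation class, `2p + r = n`, `p + r = q`; if the motivated classes
of codimension `p` on `X` are algebraic, then every `y ∈ N^q H^{2p+2r}(X(ℂ); ℂ)` is `Lʳ x` with `x ∈ Nᵖ H²ᵖ`
algebraic — take `x := *_L y`, which is MOTIVATED (André §2.1 remark "`A_mot(X)` contient `*A(X)`", tree theorem
`lefschetzInvolution_mem_motivatedClasses`, point as auxiliary variety), hence algebraic by hypothesis, and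
`Lʳ (*_L y) = y` (`lefschetzPow_lefschetzInvolution`). No named fact.
[cite: Andre1996Motifs, §2.1 remark following Déf. 1 (p. 14)] [cite: Grothendieck1968, §3 p. 196 (A(X))] -/
theorem lefschetzPow_surjOn_algebraicClasses_of_motivatedClasses_le (hX : IsSmoothProjective n X)
    (hη : IsPolarizationClass n X η) {p r q : ℕ} (hpr : 2 * p + r = n) (hq : p + r = q)
    (hmot : motivatedClasses n X p ≤ algebraicClasses X p) :
    Set.SurjOn (lefschetzPow η r (2 * p)) (algebraicClasses X p : Set (complexBetti X (2 * p)))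
      (supportedClasses X (2 * p + 2 * r) q) := by
  -- `*_L : N^q H^{2q} → H^{2p}` lands in `A_motᵖ(X)_ℂ`, in the degree spelling `i = 2q`
  have key : ∀ {i : ℕ} (z : complexBetti X i), z ∈ supportedClasses X i q → ∀ (hi : i = 2 * q)
      (hab : i + 2 * p = 2 * n), lefschetzInvolution hη.hasHardLefschetz hab z ∈ motivatedClasses n X p := by
    intro i z hz hi hab
    subst hi
    exact lefschetzInvolution_mem_motivatedClasses hX hη (show q + p = n by omega) hab hz
  intro y hy
  have hab : 2 * p + 2 * r + 2 * p = 2 * n := by omega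
  exact ⟨lefschetzInvolution hη.hasHardLefschetz hab y, hmot (key y hy (by omega) hab),
    lefschetzPow_lefschetzInvolution hη.hasHardLefschetz hpr hab y⟩

/-- **`A_motᵖ(X)_ℂ ⊆ Nᵖ H²ᵖ(X(ℂ); ℂ)` for `2 ≤ p < n/2` implies Grothendieck's `A(X, η)` for EVERY polarisation class
`η`** (`X` smooth projective of dimension `n` over `ℂ`). Clause (a) is the hard Lefschetz property of `η`; in
clause (b) "into" and "injective" are unconditional, the middle codimension is the identity and `p ≤ 1` is
Lefschetz `(1,1)` (`Ring2.AbelianAll.standardConjectureA_of_surjOn_two_le`); "onto" for `2 ≤ p`, `0 < r` is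
`lefschetzPow_surjOn_algebraicClasses_of_motivatedClasses_le`. André §2.1 (p. 14) states the converse use
("`A_mot(X) = A(X)` si … l'involution de Lefschetz est donnée par une correspondance algébrique"); this is the
cheap direction `A_mot = A ⟹ *_L A(X) ⊆ A(X)`, i.e. `A(X)`. No named fact.
[cite: Andre1996Motifs, §2.1 remark following Déf. 1 (p. 14)] [cite: Grothendieck1968, §3 p. 196 (A(X), B(X) ⇒ A(X))]
[cite: VoisinHodgeI2002, Thm. 6.25 and Thm. 11.30] -/
theorem standardConjectureA_of_motivatedClasses_le_algebraicClasses (hX : IsSmoothProjective n X)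
    (hη : IsPolarizationClass n X η)
    (hmot : ∀ p : ℕ, 2 ≤ p → 2 * p < n → motivatedClasses n X p ≤ algebraicClasses X p) :
    StandardConjectureA n X η :=
  standardConjectureA_of_surjOn_two_le hX hη fun p _ _ hp hpr hq _ ↦
    lefschetzPow_surjOn_algebraicClasses_of_motivatedClasses_le hX hη hpr hq (hmot p hp (by omega))

/-- **`A_mot(X) ⊆ A(X)` (all codimensions) implies `A(X, η)` for every polarisation class** — the shape in which the
binders `MotivatedImpliesAlgebraic[AV]` deliver it. [cite: Andre1996Motifs, §2.1 remark following Déf. 1 (p. 14)]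
[cite: Grothendieck1968, §3 p. 196 (A(X))] -/
theorem standardConjectureA_of_forall_motivatedClasses_le (hX : IsSmoothProjective n X)
    (hη : IsPolarizationClass n X η) (hmot : ∀ p : ℕ, motivatedClasses n X p ≤ algebraicClasses X p) :
    StandardConjectureA n X η :=
  standardConjectureA_of_motivatedClasses_le_algebraicClasses hX hη fun p _ _ ↦ hmot p

end PerVariety

/-! ## §2 The parent binder `MotivatedImpliesAlgebraic` implies `A(X, η)` for all `X`; the sandwich -/

/-- **`MotivatedImpliesAlgebraic ⟹ A(all)`**: André's `A_mot(X) = A(X)` for every smooth projective complex variety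
(the parent binder of row b05, `Ring2HypothesesDescent.lean` l.167) gives Grothendieck's `A(X, η)` for every smooth
projective complex `X` and every polarisation class `η`. Kernel, fact-free. [cite: Andre1996Motifs, §2.1 (p. 14)]
[cite: Grothendieck1968, §3 p. 196 (A(X))] -/
theorem forall_standardConjectureA_of_motivatedImpliesAlgebraic (h : MotivatedImpliesAlgebraic) :
    ∀ ⦃n : ℕ⦄ ⦃X : SchemeOver ℂ⦄ (η : complexBetti X 2), IsSmoothProjective n X →
      IsPolarizationClass n X η → StandardConjectureA n X η :=
  fun _ _ _ hX hη ↦ standardConjectureA_of_forall_motivatedClasses_le hX hη (h hX)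

/-- **The parent binder is SANDWICHED between the two printed forms of the Lefschetz standard conjecture**:
`B⋆(X, η)` for all smooth projective `(X, η)` ⟹ `MotivatedImpliesAlgebraic` (André §2.1, the refereed named fact
`Andre1996_motivatedClasses_le_algebraicClasses_of_standardConjectureB`, displayed as `hBA`; row b10 of
`BINDER-OWNERS.md`) and `MotivatedImpliesAlgebraic ⟹ A(X, η)` for all smooth projective `X` and all polarisation
classes (kernel, fact-free). In print the circle closes (`A(X × X) ⇒ B(X)`, Grothendieck 1968 §3; André App. A.2
p. 44 "N ⇒ B"), which the tree does not have and this file does not claim.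
[cite: Andre1996Motifs, §2.1 remark following Déf. 1 (p. 14) and Appendix A.2 (p. 44)]
[cite: Grothendieck1968, §3 p. 196 (A(X), B(X), A(X × X) ⇒ B(X))] -/
theorem motivatedImpliesAlgebraic_between_standardConjectures
    (hBA : Andre1996_motivatedClasses_le_algebraicClasses_of_standardConjectureB) :
    ((∀ (d : ℕ) (Z : SchemeOver ℂ) (η : complexBetti Z 2), IsSmoothProjective d Z →
        StandardConjectureBStar d Z η) → MotivatedImpliesAlgebraic) ∧
      (MotivatedImpliesAlgebraic → ∀ ⦃n : ℕ⦄ ⦃X : SchemeOver ℂ⦄ (η : complexBetti X 2),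
        IsSmoothProjective n X → IsPolarizationClass n X η → StandardConjectureA n X η) :=
  ⟨fun hB ↦ motivatedImpliesAlgebraic_of_standardConjectureB hB hBA,
    forall_standardConjectureA_of_motivatedImpliesAlgebraic⟩

/-! ## §3 The pencil nodes: `X_A`, `A_pen^CM` and the graded `A`-rungs from "motivated ⟹ algebraic" on total spaces -/

/-- **`(A∀)_d` from "motivated ⟹ algebraic" on the `(d+1)`-fold pencil total spaces, in the codimensions
`2 ≤ p`, `2p < d + 1` ONLY**: if for every compact pencil `f : 𝒳 ⟶ S` of abelian `d`-folds and every such `p`,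
`A_motᵖ(𝒳)_ℂ ⊆ Nᵖ H²ᵖ(𝒳(ℂ); ℂ)`, then `A(𝒳, η)` for every polarisation class of every such total space
(`Ring2.AbelianAll.StandardACompactPencilsAtRelDim d`). For `d ≤ 3` the hypothesis is empty and the rung is the
tree's fact-free `standardACompactPencilsAtRelDim_of_le_three`. [cite: Andre1996Motifs, §2.1 (p. 14) and §6.3 Remarque 2 (p. 33)]
[cite: Grothendieck1968, §3 p. 196 (A(X))] -/
theorem standardACompactPencilsAtRelDim_of_motivatedClasses_le_total {d : ℕ}
    (h : ∀ ⦃𝒳 S : SchemeOver ℂ⦄ (f : 𝒳 ⟶ S), IsCompactAbelianPencil f d → ∀ p : ℕ, 2 ≤ p →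
      2 * p < d + 1 → motivatedClasses (d + 1) 𝒳 p ≤ algebraicClasses 𝒳 p) :
    StandardACompactPencilsAtRelDim d :=
  fun _ _ f hf _ hη ↦
    standardConjectureA_of_motivatedClasses_le_algebraicClasses hf.isSmoothProjective_total hη (h f hf)

/-- **THE FIRST OPEN `A`-RUNG `d = 4` from ONE `η`-free inclusion per pencil**: if on the FIVEFOLD total space `𝒳`
of every compact pencil of abelian fourfolds the motivated classes of codimension `2` are algebraic,
`A_mot²(𝒳)_ℂ ⊆ N² H⁴(𝒳(ℂ); ℂ)`, then `(A∀)_4` (`A(𝒳, η)` for every polarisation class; part XIV-c isolates it as the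
surjectivity `L_η(N² H⁴) ⊇ N³ H⁶`, `standardACompactPencilsAtRelDim_four_iff_surjOn`). The hypothesis is implied
by, and a priori finer than, "rational `(2,2)`-classes on `𝒳` are algebraic" (`A_mot² ⊆ span Hdg²`, André §2.5 c)).
OPEN; a sufficient condition, not a proof. [cite: Andre1996Motifs, §2.1 (p. 14) and §2.5 c) (p. 18)]
[cite: Grothendieck1968, §3 p. 196 (A(X))] -/
theorem standardACompactPencilsAtRelDim_four_of_motivatedClasses_two_le
    (h : ∀ ⦃𝒳 S : SchemeOver ℂ⦄ (f : 𝒳 ⟶ S), IsCompactAbelianPencil f 4 →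
      motivatedClasses 5 𝒳 2 ≤ algebraicClasses 𝒳 2) :
    StandardACompactPencilsAtRelDim 4 := by
  refine standardACompactPencilsAtRelDim_of_motivatedClasses_le_total fun 𝒳 S f hf p hp hpn ↦ ?_
  obtain rfl : p = 2 := by omega
  exact h f hf

/-- **`X_A` from "motivated ⟹ algebraic" on the pencil total spaces below the middle**: the blanket node
`Ring2.AbelianAll.CompactAbelianPencilStandardA` (print's letter for Abdulali p. 1122 / Milne 2020 Prop. 1) follows
from `A_motᵖ(𝒳)_ℂ ⊆ Nᵖ H²ᵖ(𝒳(ℂ); ℂ)` for all compact abelian pencils `𝒳 → S` of relative dimension `d` and all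
`2 ≤ p`, `2p < d + 1`. [cite: Andre1996Motifs, §6.3 Remarque 2 (p. 33)] [cite: Milne2020HodgeClassesAV, Prop. 1 (p. 7)]
[cite: Grothendieck1968, §3 p. 196 (A(X))] -/
theorem compactAbelianPencilStandardA_of_motivatedClasses_le_total
    (h : ∀ ⦃d : ℕ⦄ ⦃𝒳 S : SchemeOver ℂ⦄ (f : 𝒳 ⟶ S), IsCompactAbelianPencil f d → ∀ p : ℕ, 2 ≤ p →
      2 * p < d + 1 → motivatedClasses (d + 1) 𝒳 p ≤ algebraicClasses 𝒳 p) :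
    CompactAbelianPencilStandardA :=
  fun _ _ _ f hf _ hη ↦
    standardConjectureA_of_motivatedClasses_le_algebraicClasses hf.isSmoothProjective_total hη (h f hf)

/-- **`MotivatedImpliesAlgebraic ⟹ X_A`**: the parent binder of row b05 gives print's `A`-letter node on every
compact abelian pencil. Kernel, fact-free. [cite: Andre1996Motifs, §2.1 (p. 14) and §6.3 Remarque 2 (p. 33)]
[cite: Grothendieck1968, §3 p. 196 (A(X))] -/
theorem compactAbelianPencilStandardA_of_motivatedImpliesAlgebraic (h : MotivatedImpliesAlgebraic) :
    CompactAbelianPencilStandardA :=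
  fun _ _ _ _ hf η hη ↦
    forall_standardConjectureA_of_motivatedImpliesAlgebraic h η hf.isSmoothProjective_total hη

/-- **`MotivatedImpliesAlgebraic ⟹ A_pen^CM`** (the CM-pointed node, through `X_A ⟹ A_pen^CM` of part XIV).
[cite: Andre1996Motifs, Lemme 6.3.1 (ii) (p. 31) and Remarque 2 (p. 33)] -/
theorem cmPointedPencilStandardA_of_motivatedImpliesAlgebraic (h : MotivatedImpliesAlgebraic) :
    CMPointedPencilStandardA :=
  cmPointedPencilStandardA_of_compactAbelianPencilStandardA
    (compactAbelianPencilStandardA_of_motivatedImpliesAlgebraic h)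

/-- **`MotivatedImpliesAlgebraic ⟹ (A∀)_d ∧ (A^CM)_d` for every relative dimension `d`**. [folklore]
[cite: Grothendieck1968, §3 p. 196 (A(X))] -/
theorem standardARungs_of_motivatedImpliesAlgebraic (h : MotivatedImpliesAlgebraic) (d : ℕ) :
    StandardACompactPencilsAtRelDim d ∧ StandardACMPointedPencilsAtRelDim d :=
  have hd : StandardACompactPencilsAtRelDim d := fun _ _ _ hf η hη ↦
    forall_standardConjectureA_of_motivatedImpliesAlgebraic h η hf.isSmoothProjective_total hη
  ⟨hd, standardACMPointedPencilsAtRelDim_of_compact hd⟩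

/-! ## §4 The placement of print's letter `X_A`: between the parent binder and row b05 -/

/-- **`MotivatedImpliesAlgebraic ⟹ X_A ⟹ MotivatedImpliesAlgebraicAV`**: print's `A`-letter node lies BETWEEN the
parent binder (l.167) and row b05 (l.177) — the first arrow kernel and fact-free (§3), the second the landed bridge
`X_A ⟹ HC_AV` (part XIV-b `HC_AV_and_HC_CM_of_abdulaliA_of_andre1996_of_compactAbelianPencilStandardA`, then part XXV
`motivatedImpliesAlgebraicAV_of_hc_av_holds`; = `Ring2HypothesesDescentMotivatedRungs` :94, re-derived in two lines so
that this module does not import that one) modulo the three displayed print binders `h₈A` (Abdulali p. 1122 with the Lefschetz hypothesis as printed), `h₂₁` (Lemme 6.3.1),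
`h₂₂` (Lemmes 6.3.2–6.3.3). The composite is weaker than the trivial `motivatedImpliesAlgebraicAV_of_all`; the
content is the position of `X_A`. [cite: Andre1996Motifs, §6.3 Lemmes 6.3.1–6.3.3 and Remarque 2 (pp. 31–33)]
[cite: Abdulali1994FamiliesAV, p. 1122] [cite: Milne2020HodgeClassesAV, Prop. 1 (p. 7) and Thm. 4] -/
theorem compactAbelianPencilStandardA_between_motivatedBinders
    (h₈A : Abdulali1994_invariantCycles_of_lefschetzStandardA) (h₂₁ : andre1996_cmAnchoredPencil)
    (h₂₂ : andre1996_cmHodgeClasses_algebraicallyAnchoredPencils) :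
    (MotivatedImpliesAlgebraic → CompactAbelianPencilStandardA) ∧
      (CompactAbelianPencilStandardA → MotivatedImpliesAlgebraicAV) :=
  ⟨compactAbelianPencilStandardA_of_motivatedImpliesAlgebraic, fun hA ↦
    motivatedImpliesAlgebraicAV_of_hc_av_holds
      (HC_AV_and_HC_CM_of_abdulaliA_of_andre1996_of_compactAbelianPencilStandardA h₈A h₂₁ h₂₂ hA).1⟩

/-- **A sufficient package for `HC_AV` on the motivated axis NOT passing through André's Thm. 0.6.2**: "motivated
⟹ algebraic" on the compact-abelian-pencil TOTAL SPACES in the codimensions `2 ≤ p`, `2p < d + 1`, together with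
`h₈A`, `h₂₁`, `h₂₂`, gives `HC_AV` (through `X_A` and the landed Milne 2020 Thm. 4 row
`HC_AV_and_HC_CM_of_abdulaliA_of_andre1996_of_compactAbelianPencilStandardA`). Compare
`hc_av_of_andre_of_motivatedImpliesAlgebraicAV` (Thm. 0.6.2 `hAM` + row b05): here the motivated hypothesis sits on
the pencil total spaces instead of the abelian varieties, and André's deep theorem is replaced by transport.
`HC_CM` is idle (a consequence: `.2` of the row used). OPEN hypotheses displayed; nothing asserted.
[cite: Milne2020HodgeClassesAV, Thm. 4 and Rem. 3] [cite: Andre1996Motifs, §6.3 Remarque 2 (p. 33)]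
[cite: Abdulali1994FamiliesAV, p. 1122] -/
theorem hc_av_of_abdulaliA_of_andre1996_of_motivatedClasses_le_total
    (h₈A : Abdulali1994_invariantCycles_of_lefschetzStandardA) (h₂₁ : andre1996_cmAnchoredPencil)
    (h₂₂ : andre1996_cmHodgeClasses_algebraicallyAnchoredPencils)
    (h : ∀ ⦃d : ℕ⦄ ⦃𝒳 S : SchemeOver ℂ⦄ (f : 𝒳 ⟶ S), IsCompactAbelianPencil f d → ∀ p : ℕ, 2 ≤ p →
      2 * p < d + 1 → motivatedClasses (d + 1) 𝒳 p ≤ algebraicClasses 𝒳 p) :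
    Theses.PadicSemiregularLift.HodgeAbelianVarieties :=
  (HC_AV_and_HC_CM_of_abdulaliA_of_andre1996_of_compactAbelianPencilStandardA h₈A h₂₁ h₂₂
    (compactAbelianPencilStandardA_of_motivatedClasses_le_total h)).1

/-- … and therefore row b05 itself from the pencil-total hypothesis (through `HC_AV` and part XXV
`motivatedImpliesAlgebraicAV_of_hc_av_holds`), modulo `h₈A h₂₁ h₂₂`. [cite: Andre1996Motifs, §6.3 Remarque 2 (p. 33)]
[cite: Milne2020HodgeClassesAV, Thm. 4] -/
theorem motivatedImpliesAlgebraicAV_of_abdulaliA_of_andre1996_of_motivatedClasses_le_total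
    (h₈A : Abdulali1994_invariantCycles_of_lefschetzStandardA) (h₂₁ : andre1996_cmAnchoredPencil)
    (h₂₂ : andre1996_cmHodgeClasses_algebraicallyAnchoredPencils)
    (h : ∀ ⦃d : ℕ⦄ ⦃𝒳 S : SchemeOver ℂ⦄ (f : 𝒳 ⟶ S), IsCompactAbelianPencil f d → ∀ p : ℕ, 2 ≤ p →
      2 * p < d + 1 → motivatedClasses (d + 1) 𝒳 p ≤ algebraicClasses 𝒳 p) :
    MotivatedImpliesAlgebraicAV :=
  motivatedImpliesAlgebraicAV_of_hc_av_holds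
    (hc_av_of_abdulaliA_of_andre1996_of_motivatedClasses_le_total h₈A h₂₁ h₂₂ h)

/-! ## §5 Row b05 itself on the standard-conjecture side: `A(A, η)` for abelian varieties -/

/-- **Row b05 ⟹ `A(A, η)` for every complex abelian variety `A` and every polarisation class `η`**, fact-free —
indeed from the LOWER HALF `2 ≤ p`, `2p < dim A` of the row's middle range (`motivatedImpliesAlgebraicAV_iff_middleRange`).
In print this carries no information: `B(A)`, hence `A(A, L)`, is Lieberman's THEOREM (1968; Kleiman Thm. 2A11);
in the tree `B⋆(A)` is the unproved named fact `Lieberman1968_lefschetzInvolution_algebraic_abelianVariety`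
(`standardConjectureA_abelianVariety_of_lieberman` below), so the kernel value of this lemma is that row b05
delivers the `A`-form of that binder without it. [cite: Lieberman1968, main theorem (B(A))]
[cite: Kleiman1968AlgebraicCycles, Appendix to §2, Thm. 2A11] [cite: Grothendieck1968, §3 p. 196 (A(X))] -/
theorem standardConjectureA_abelianVariety_of_motivatedClasses_le_lowerHalf
    (h : ∀ (A : AbelianVariety ℂ) (p : ℕ), 2 ≤ p → 2 * p < A.dim →
      motivatedClasses A.dim A.X p ≤ algebraicClasses A.X p)
    (A : AbelianVariety ℂ) {η : complexBetti A.X 2} (hη : IsPolarizationClass A.dim A.X η) :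
    StandardConjectureA A.dim A.X η :=
  standardConjectureA_of_motivatedClasses_le_algebraicClasses (AbelianVariety.isSmoothProjective_holds (A := A))
    hη (h A)

/-- **`MotivatedImpliesAlgebraicAV ⟹ A(A, η)`** for every complex abelian variety and polarisation class (fact-free;
see `standardConjectureA_abelianVariety_of_motivatedClasses_le_lowerHalf` for the print status).
[cite: Grothendieck1968, §3 p. 196 (A(X))] [cite: Andre1996Motifs, §2.1 (p. 14)] -/
theorem standardConjectureA_abelianVariety_of_motivatedImpliesAlgebraicAV (h : MotivatedImpliesAlgebraicAV)
    (A : AbelianVariety ℂ) {η : complexBetti A.X 2} (hη : IsPolarizationClass A.dim A.X η) :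
    StandardConjectureA A.dim A.X η :=
  standardConjectureA_of_forall_motivatedClasses_le (AbelianVariety.isSmoothProjective_holds (A := A)) hη (h A)

/-- **The print status of §5, in the kernel: `A(A, η)` for abelian varieties modulo Lieberman's theorem** (the
named fact `hL : B⋆(A)` for every complex abelian variety, unproved in the tree) — `B ⇒ A` on the real carriers
(part XIV `standardConjectureA_of_standardConjectureBStar`). [cite: Lieberman1968, main theorem (B(A))]
[cite: Kleiman1968AlgebraicCycles, Appendix to §2, Thm. 2A11] [cite: Grothendieck1968, §3 p. 196 (B(X) ⇒ A(X))] -/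
theorem standardConjectureA_abelianVariety_of_lieberman
    (hL : Lieberman1968_lefschetzInvolution_algebraic_abelianVariety) (A : AbelianVariety ℂ)
    {η : complexBetti A.X 2} (hη : IsPolarizationClass A.dim A.X η) : StandardConjectureA A.dim A.X η :=
  standardConjectureA_of_standardConjectureBStar (AbelianVariety.isSmoothProjective_holds (A := A)) hη (hL A η)

/-! ## §6 The standard-conjecture side of row b05 as one conjunction -/

/-- **Row b05 and its parent on the standard-conjecture side, one conjunction a referee can quote** (all
fact-free except the displayed `hBA`, `h₈A`, `h₂₁`, `h₂₂`): (i) per variety, `A_mot ⊆ A` in codimensions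
`2 ≤ p < n/2` ⟹ `A(X, η)`; (ii) the parent binder sandwiched `B⋆(all) ⟹ parent ⟹ A(all)`; (iii) `parent ⟹ X_A ⟹ row
b05`; (iv) the first open `A`-rung `d = 4` from `A_mot² ⊆ N² H⁴` on fivefold pencil total spaces; (v) row b05 ⟹
`A(A, η)` for abelian varieties. Nothing here asserts `HC_CM`, `HC_AV`, `X_A`, row b05 or its parent.
[cite: Andre1996Motifs, §2.1 (p. 14), §6.3 Remarque 2 (p. 33)] [cite: Grothendieck1968, §3 p. 196 (A(X), B(X))]
[cite: Milne2020HodgeClassesAV, Prop. 1 and Thm. 4] -/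
theorem b05_standardConjecture_ledger
    (hBA : Andre1996_motivatedClasses_le_algebraicClasses_of_standardConjectureB)
    (h₈A : Abdulali1994_invariantCycles_of_lefschetzStandardA) (h₂₁ : andre1996_cmAnchoredPencil)
    (h₂₂ : andre1996_cmHodgeClasses_algebraicallyAnchoredPencils) :
    (∀ ⦃n : ℕ⦄ ⦃X : SchemeOver ℂ⦄ ⦃η : complexBetti X 2⦄, IsSmoothProjective n X → IsPolarizationClass n X η →
        (∀ p : ℕ, 2 ≤ p → 2 * p < n → motivatedClasses n X p ≤ algebraicClasses X p) →
          StandardConjectureA n X η) ∧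
      (((∀ (d : ℕ) (Z : SchemeOver ℂ) (η : complexBetti Z 2), IsSmoothProjective d Z →
          StandardConjectureBStar d Z η) → MotivatedImpliesAlgebraic) ∧
        (MotivatedImpliesAlgebraic → ∀ ⦃n : ℕ⦄ ⦃X : SchemeOver ℂ⦄ (η : complexBetti X 2),
          IsSmoothProjective n X → IsPolarizationClass n X η → StandardConjectureA n X η)) ∧
      ((MotivatedImpliesAlgebraic → CompactAbelianPencilStandardA) ∧
        (CompactAbelianPencilStandardA → MotivatedImpliesAlgebraicAV)) ∧
      ((∀ ⦃𝒳 S : SchemeOver ℂ⦄ (f : 𝒳 ⟶ S), IsCompactAbelianPencil f 4 →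
          motivatedClasses 5 𝒳 2 ≤ algebraicClasses 𝒳 2) → StandardACompactPencilsAtRelDim 4) ∧
      (MotivatedImpliesAlgebraicAV → ∀ (A : AbelianVariety ℂ) (η : complexBetti A.X 2),
        IsPolarizationClass A.dim A.X η → StandardConjectureA A.dim A.X η) :=
  ⟨fun _ _ _ hX hη hmot ↦ standardConjectureA_of_motivatedClasses_le_algebraicClasses hX hη hmot,
    motivatedImpliesAlgebraic_between_standardConjectures hBA,
    compactAbelianPencilStandardA_between_motivatedBinders h₈A h₂₁ h₂₂,
    standardACompactPencilsAtRelDim_four_of_motivatedClasses_two_le,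
    fun h A _ hη ↦ standardConjectureA_abelianVariety_of_motivatedImpliesAlgebraicAV h A hη⟩

end Summit.HodgeConjecture.HodgeConjecture.Ring2.Hypotheses

end
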